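import Literature.AlgebraicGeometry.HodgeTheory.SmallChowGroupsHodgeConjectureProofs
import Literature.AlgebraicGeometry.HodgeTheory.ComplexGysin
import Literature.AlgebraicGeometry.Resolution.ProjectiveResolutionProofs
import HarnessLib

/-!
# `CH₀(X) ⊗ ℚ = ℚ` forces geometric coniveau `≥ 1` in every positive degree (Bloch–Srinivas 1983; Voisin, JOMP 2025, Prop. 5.5 / Cor. 5.7)

Family `hodge`, layer `Literature/AlgebraicGeometry/HodgeTheory`. Source: C. Voisin, *Hodge and
generalized Hodge conjectures, coniveau and algebraic cycles*, J. Open Math. Probl. 1 (2025) 16–51,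
§5.2, verbatim: "Proposition 5.5. If `X` has a cohomological decomposition of the diagonal in
codimension `c`, then `H*(X, ℚ) = H*(X, ℚ)_alg + N_c H*(X, ℚ)`, where `N_c H*(X, ℚ)` denotes
cohomology of geometric coniveau `≥ c`. If `c = 1`, `H^{*>0}(X, ℚ)` has geometric coniveau `≥ 1`.
[…] Theorem 5.6. Let `X` be a smooth projective complex variety. Assume that `CH₀(X) = ℤ`. Then `X`
admits a cohomological decomposition of the diagonal in codimension `1`. […] Corollary 5.7. The
assumptions on `X` being as in Theorem 5.6, `H^{*>0}(X, ℚ)` has geometric coniveau `≥ 1`." (the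
method of S. Bloch, V. Srinivas, *Remarks on correspondences and algebraic cycles*, Amer. J. Math.
105 (1983); C. Voisin, *Hodge Theory and Complex Algebraic Geometry II* (2003), proof of Thm. 10.17,
(10.7)–(10.9)).

## Content (all proved; relative to a Gysin / cycle-class formalism `G : GysinFormalism`, a PARAMETER)

* `GysinFormalism.corrAct_primeCycle_mem_supportedClasses_of_le_coheight` — (10.8) in support form,
  every degree `k` and codimension `r`: a prime correspondence `[V]`, `V = closure {z} ⊆ X ⊗ X`, with
  `codim pr₁(z) ≥ r` maps `Hᵏ(X(ℂ); ℂ)` into `Nʳ Hᵏ(X(ℂ); ℂ) = supportedClasses X k r` (the case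
  `k = 2p`, `r = p` is the tree's `…_mem_algebraicClasses_of_le_coheight`).
* `GysinFormalism.corrAct_mem_supportedClasses_of_fst_mem` — hence a correspondence supported in
  `T × X`, `T` Zariski-closed of codimension `≥ r`, maps `Hᵏ` into `Nʳ Hᵏ`.
* `GysinFormalism.corrAct_primeCycle_eq_zero_of_two_mul_height_snd_lt` — (10.9) for ALL classes:
  if `2 dim pr₂(z) < k` then `[V]^* = 0` on `Hᵏ(X(ℂ); ℂ)`, because `[V]^* = [Ṽ]^* ∘ j̃^*` through a
  projective resolution `j̃ : X̃' → closure {pr₂ z}` (projective Hironaka, PROVED in the tree: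
  `Resolution.Hironaka1964_projective_holds`) and `Hᵏ(X̃'(ℂ); ℂ) = 0` above the real dimension
  (`subsingleton_complexBetti`). No Hodge theory is used (the tree's `…_eq_zero_of_height_snd_lt`
  treats `(p,p)`-classes in degree `2p` through `IsOfHodgeType.eq_zero_of_two_mul_lt`).
* `GysinFormalism.supportedClasses_eq_top_of_chowRankLEOneUpTo_zero` — **Cor. 5.7 on the tree's
  carriers**: for `X` smooth projective of dimension `n` over `ℂ` with `dim_ℚ CH₀(X) ⊗ ℚ ≤ 1`
  (`Motives.ChowRankLEOneUpTo X 0`) and every `k ≥ 1`, `N¹ Hᵏ(X(ℂ); ℂ) = Hᵏ(X(ℂ); ℂ)`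
  (`supportedClasses X k 1 = ⊤`). Proof as printed: the decomposition `m[Δ_X] ∼_rat Z₀ + Z'` with
  `Z₀ ⊂ W'₀ × W₀`, `dim W₀ = 0`, `Z' ⊂ T × X`, `codim T ≥ 1` (Voisin II Cor. 10.28 / Thm. 10.29 at
  `k₀ = 0`, PROVED in the tree: `Motives.ParanjapeLaterveer_generalisedDecompositionOfTheDiagonal_holds`);
  `[Δ_X]^* = Id` and Lemma 9.18 give `m α = [Z₀]^*α + [Z']^*α`; `[Z₀]^*α = 0` for `deg α ≥ 1`
  (vanishing case, `pr₂` of every component is a closed point) and `[Z']^*α ∈ N¹` (support case);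
  `m ≠ 0` is invertible in `ℂ`. `…_of_chowGroup` is the same with the hypothesis on the Chow group
  `CH₀(X) = Z₀(X)/Rat₀(X)`.

The only non-constructed input is the formalism `G` (Gysin morphisms and cycle classes on
`H*(–(ℂ); ℂ)` with their printed properties, `HodgeTheory/GysinFormalism`; its intended instance is
to be supplied by a construction — there is deliberately no existence fact, D-0026), taken as a
parameter exactly as in `SmallChowGroupsHodgeConjectureProofs` and
`Barriers/HodgeConjecture/DecompositionOfTheDiagonalDegreeFourOfGysin`.

Consumers: the generalized Hodge conjecture in coniveau `1` (Voisin 2025, Conj. 4.6 with `c = 1`: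
`h^{k,0} = 0 ⟹ N¹ Hᵏ = Hᵏ`) in the sector `CH₀(X)_ℚ = ℚ` — e.g. the support item
`ConiveauOneOfVanishingGenus` of the route `HodgeConjecture/LinearSystemTorelli`, and
`supportedClasses X 4 1 = ⊤` for rationally connected fourfolds (cubic, quartic, quintic fourfolds).

## References

* [Voisin2025] C. Voisin, Hodge and generalized Hodge conjectures, coniveau and algebraic cycles,
  J. Open Math. Probl. 1 (2025) 16–51, Def. 5.3, Prop. 5.5, Thm. 5.6, Cor. 5.7.
* [BlochSrinivas1983] S. Bloch, V. Srinivas, Remarks on correspondences and algebraic cycles,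
  Amer. J. Math. 105 (1983) 1235–1253, Thm. 1.
* [VoisinHodgeII2003] C. Voisin, Hodge Theory and Complex Algebraic Geometry II (2003), Lemma 9.18,
  proof of Thm. 10.17 ((10.7)–(10.9)), Cor. 10.28, Thm. 10.29.
* [Kollar2007] J. Kollár, Lectures on Resolution of Singularities (2007), Thm. 3.27.
-/

noncomputable section

open CategoryTheory CategoryTheory.Limits AlgebraicGeometry MonoidalCategory CartesianMonoidalCategory

namespace Literature.AlgebraicGeometry.HodgeTheory

open Literature.AlgebraicGeometry.Motives
open Literature.AlgebraicTopology.SingularHomology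

section HodgeTheory

variable {n : ℕ} {X : SchemeOver ℂ}

/-! ### (10.8): the support case in every degree and codimension -/

/-- **(Support case, every degree.)** If `V = closure {z} ⊆ X ⊗ X` has `pr₁(z)` of codimension
`≥ r`, then `[V]^*c ∈ Nʳ Hᵏ(X(ℂ); ℂ) = supportedClasses X k r` for every `c ∈ Hᵏ(X(ℂ); ℂ)`: `[V]^*c`
vanishes off `closure {pr₁ z}` (Voisin II (10.8) in support form, `GysinFormalism.restrictCompl_corrAct`),
all of whose points have codimension `≥ r`.
[cite: VoisinHodgeII2003, proof of Thm. 10.17 (10.8) and proof of Lemma 9.18] -/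
theorem GysinFormalism.corrAct_primeCycle_mem_supportedClasses_of_le_coheight (G : GysinFormalism)
    (hX : IsSmoothProjective n X) (z : ↥(X ⊗ X).left)
    (hz : primeCycle z ∈ cyclesOfDim (X ⊗ X).left n) (k : ℕ) {r : ℕ}
    (hr : (r : ℕ∞) ≤ Order.coheight ((fst X X).left.base z)) (c : complexBetti X k) :
    G.corrAct hX hX k ⟨primeCycle z, hz⟩ c ∈ supportedClasses X k r := by
  refine mem_supportedClasses_of_restrictCompl_eq_zero (Z := closure {(fst X X).left.base z})
    isClosed_closure (fun y hy ↦ hr.trans (coheight_le_coheight_of_mem_closure hy))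
    (G.restrictCompl_corrAct hX hX k isClosed_closure ?_ c)
  intro w hw
  have hwz : w = z := by
    by_contra h
    exact hw (primeCycle_apply_of_ne h)
  rw [hwz]
  exact subset_closure rfl

/-- **A correspondence supported in `T × X` maps `Hᵏ` into `Nʳ Hᵏ`** for `T ⊆ X` Zariski-closed
all of whose points have codimension `≥ r` (`pr₁ z ∈ T` whenever `Z z ≠ 0`): `[Z]^*c` vanishes on
`(X ∖ T)(ℂ)` (Voisin II (10.8): "`Im α_r^*` is composed of classes supported on `T`";
Voisin 2025, proof of Prop. 5.5: "`[Γ]^*α` vanishes away from `D_c`").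
[cite: VoisinHodgeII2003, proof of Thm. 10.17 (10.8)] [cite: Voisin2025, Prop. 5.5 (proof)] -/
theorem GysinFormalism.corrAct_mem_supportedClasses_of_fst_mem (G : GysinFormalism)
    (hX : IsSmoothProjective n X) (k : ℕ) {Z : ↥(cyclesOfDim (X ⊗ X).left n)} {T : Set X.left}
    (hT : IsClosed T) {r : ℕ} (hTr : ∀ t ∈ T, (r : ℕ∞) ≤ Order.coheight t)
    (hZ : ∀ z, (Z : AlgebraicCycle (X ⊗ X).left ℤ) z ≠ 0 → (fst X X).left.base z ∈ T)
    (c : complexBetti X k) :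
    G.corrAct hX hX k Z c ∈ supportedClasses X k r :=
  mem_supportedClasses_of_restrictCompl_eq_zero hT hTr (G.restrictCompl_corrAct hX hX k hT hZ c)

/-! ### (10.9): the vanishing case for all classes above the real dimension of the second support -/

/-- **(Vanishing case, all classes.)** If `V = closure {z} ⊆ X ⊗ X` is `n`-dimensional and
`2 dim pr₂(z) < k`, then `[V]^* = 0` on `Hᵏ(X(ℂ); ℂ)`: with `j̃ : X̃' → closure {pr₂ z} ⊆ X` a
projective resolution (projective Hironaka, `Resolution.Hironaka1964_projective_holds`; Kollár
Thm. 3.27) and `[Ṽ]` the lift of `[V]` along `X ◁ j̃` (`Motives.primeCycle_lift_of_isBirational_holds`),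
`[V]^*c = [Ṽ]^*(j̃^*c)` (Voisin II (10.9)), and `j̃^*c ∈ Hᵏ(X̃'(ℂ); ℂ) = 0` since `k > 2 dim X̃'`
(`subsingleton_complexBetti`). Voisin 2025, proof of Prop. 5.5, `c = 1`: the decomposable term
`[W]^*α = Σ nᵢ [Wᵢ] ⟨α, [W'_{n-i}]⟩` vanishes in positive degree when `W = X × x`.
[cite: VoisinHodgeII2003, proof of Thm. 10.17 (10.9)] [cite: Voisin2025, Prop. 5.5 (proof)]
[cite: Kollar2007, Thm. 3.27] -/
theorem GysinFormalism.corrAct_primeCycle_eq_zero_of_two_mul_height_snd_lt (G : GysinFormalism)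
    (hX : IsSmoothProjective n X) (z : ↥(X ⊗ X).left)
    (hz : primeCycle z ∈ cyclesOfDim (X ⊗ X).left n) (hzn : Order.height z = n) {k : ℕ}
    (hlt : 2 * Order.height ((snd X X).left.base z) < (k : ℕ∞)) (c : complexBetti X k) :
    G.corrAct hX hX k ⟨primeCycle z, hz⟩ c = 0 := by
  classical
  set x' := (snd X X).left.base z with hx'
  set X₀ := ClosedSubvariety.ofPoint X.left x' with hX₀
  obtain ⟨d', X₁, π, hX₁, hπ, hdim⟩ :=
    exists_resolution_ofPoint Resolution.Hironaka1964_projective_holds hX x'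
  -- `2 d' = 2 dim closure {x'} < k`
  have hd'k : 2 * d' < k := by
    rw [hdim] at hlt
    exact_mod_cast hlt
  have hXX₁ := IsSmoothProjective.tensor_holds hX hX₁
  haveI := noetherianSpace_of_isSmoothProjective hXX₁
  set j : X₁ ⟶ X := π ≫ X₀.ιOver with hj
  -- lift `[closure z]` along `X ◁ j`
  obtain ⟨z₁, hz₁, hmap⟩ := primeCycle_lift_of_isBirational_holds hX hX hX₁ X₀ j π.left rfl hπ z
    (by rw [ClosedSubvariety.genericPoint_ofPoint])
  have hz₁n : primeCycle z₁ ∈ cyclesOfDim (X ⊗ X₁).left n := primeCycle_mem_cyclesOfDim (by rw [hz₁, hzn])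
  have hpush : cyclesOfDimMap n (X ◁ j).left ⟨primeCycle z₁, hz₁n⟩ = ⟨primeCycle z, hz⟩ :=
    Subtype.ext hmap
  -- (10.9): `[V]^*c = [Ṽ]^*(j^*c)`
  rw [← hpush, G.corrAct_eq_corrActGen,
    G.corrActGen_cyclesOfDimMap_whiskerLeft hX hX hX₁ j rfl (show n + d' = n + d' from rfl) rfl
      (show k + 2 * d' = k + 2 * d' from rfl) ⟨primeCycle z₁, hz₁n⟩,
    LinearMap.comp_apply]
  -- `j^*c ∈ Hᵏ(X₁(ℂ); ℂ) = 0` as `k > 2 dim X₁`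
  haveI := subsingleton_complexBetti hX₁ hd'k
  rw [Subsingleton.elim ((complexBetti.map j k).hom c) 0, map_zero]

/-! ### Cor. 5.7: `CH₀(X)_ℚ = ℚ` ⟹ `N¹ Hᵏ = Hᵏ` for `k ≥ 1` -/

/-- **Bloch–Srinivas (1983); Voisin 2025, Cor. 5.7, on the tree's carriers.** Let `X` be a smooth
projective complex variety of dimension `n` with `dim_ℚ CH₀(X) ⊗ ℚ ≤ 1`
(`Motives.ChowRankLEOneUpTo X 0`: any two `0`-cycles have `ℤ`-dependent classes; "`CH₀(X) = ℤ`").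
Then for every `k ≥ 1` all of `Hᵏ(X(ℂ); ℂ)` is supported in codimension `≥ 1`:
`supportedClasses X k 1 = ⊤` ("`H^{*>0}(X, ℚ)` has geometric coniveau `≥ 1`"), granted a Gysin /
cycle-class formalism `G`. Proof as printed: `m[Δ_X] ∼_rat Z₀ + Z'` with `Z₀ ⊂ W'₀ × W₀`,
`dim W₀ = 0`, `Z' ⊂ T × X`, `codim T ≥ 1`
(`Motives.ParanjapeLaterveer_generalisedDecompositionOfTheDiagonal_holds`, `k₀ = 0`); by Lemma 9.18
and `[Δ_X]^* = Id`, `m c = [Z₀]^*c + [Z']^*c`; `[Z₀]^*c = 0` in degree `k ≥ 1 > 2·0` (vanishing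
case over each component) and `[Z']^*c ∈ N¹ Hᵏ` (support case); `m ≠ 0` is invertible in `ℂ`.
[cite: Voisin2025, Prop. 5.5, Thm. 5.6 and Cor. 5.7] [cite: BlochSrinivas1983, Thm. 1]
[cite: VoisinHodgeII2003, Lemma 9.18, proof of Thm. 10.17 and Cor. 10.28] -/
theorem GysinFormalism.supportedClasses_eq_top_of_chowRankLEOneUpTo_zero (G : GysinFormalism)
    (hX : IsSmoothProjective n X) (hCH : ChowRankLEOneUpTo X 0) {k : ℕ} (hk : 1 ≤ k) :
    supportedClasses X k 1 = ⊤ := by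
  classical
  -- a generic point `δ` of the diagonal, and `[Δ]` as an `n`-cycle
  haveI := GysinFormalism.isClosedImmersion_diagonal_left hX
  haveI := irreducibleSpace_of_isSmoothProjective' hX
  set Δ := (lift (𝟙 X) (𝟙 X)).left with hΔ
  obtain ⟨δ, hδ⟩ : ∃ δ : ↥(X ⊗ X).left, IsGenericPoint δ (Set.range Δ.base) := by
    refine ⟨Δ.base (genericPoint X.left), ?_⟩
    have h := (genericPoint_spec X.left).image Δ.base.hom.continuous
    rwa [Set.image_univ, Δ.isClosedEmbedding.isClosed_range.closure_eq] at h
  have hn : primeCycle δ ∈ cyclesOfDim (X ⊗ X).left n :=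
    primeCycle_mem_cyclesOfDim (height_eq_of_isGenericPoint_diagonal' hX hδ)
  -- the decomposition `m[Δ] ∼ Z₀ + Z'` (Cor. 10.28 / Thm. 10.29 at `k₀ = 0`)
  obtain ⟨m, hm, T, hT, hcod, Z', hZ', hZ'T, Z₀, hZ₀, W₀, W'₀, -, -, hW₀, hsupp, hrat⟩ :=
    ParanjapeLaterveer_generalisedDecompositionOfTheDiagonal_holds.zero hX hCH δ hδ
  have hrat' : IsRationallyEquivalent
      ((m • ⟨primeCycle δ, hn⟩ : ↥(cyclesOfDim (X ⊗ X).left n)) : AlgebraicCycle (X ⊗ X).left ℤ)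
      ((⟨Z₀, hZ₀⟩ + ⟨Z', hZ'⟩ : ↥(cyclesOfDim (X ⊗ X).left n)) : AlgebraicCycle (X ⊗ X).left ℤ) n := by
    rw [AddSubgroup.coe_add]
    exact hrat
  -- Lemma 9.18 and `[Δ]^* = Id`: `m • c = [Z₀]^*c + [Z']^*c`
  have hact := G.corrAct_congr hX hX k hrat'
  rw [map_nsmul, map_add, G.corrAct_primeCycle_diagonal hX k δ hδ hn] at hact
  refine eq_top_iff.2 fun c _ ↦ ?_
  have hmc : (m : ℂ) • c = G.corrAct hX hX k ⟨Z₀, hZ₀⟩ c + G.corrAct hX hX k ⟨Z', hZ'⟩ c := by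
    have h := LinearMap.congr_fun hact c
    simp only [LinearMap.smul_apply, LinearMap.id_apply, LinearMap.add_apply] at h
    rw [← h, Nat.cast_smul_eq_nsmul ℂ m c]
  -- `[Z₀]^*c = 0` (every component lies over a closed point of `W₀`) and `[Z']^*c ∈ N¹`
  have hmem : (m : ℂ) • c ∈ supportedClasses X k 1 := by
    rw [hmc]
    refine add_mem ?_ (G.corrAct_mem_supportedClasses_of_fst_mem hX k hT hcod hZ'T c)
    refine G.corrAct_mem_of_primeCycle hX hX k _ ⟨Z₀, hZ₀⟩ c fun z hz0 hz ↦ ?_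
    have h0 : Order.height ((snd X X).left.base z) ≤ ((0 : ℕ) : ℕ∞) := hW₀ _ (hsupp z hz0).2
    rw [G.corrAct_primeCycle_eq_zero_of_two_mul_height_snd_lt hX z hz (hZ₀ z hz0) ?_ c]
    · exact Submodule.zero_mem _
    · have h0' : Order.height ((snd X X).left.base z) = 0 := nonpos_iff_eq_zero.mp (by simpa using h0)
      rw [h0', mul_zero]
      exact_mod_cast hk
  -- and `m` is invertible in `ℂ`
  have hm0 : (m : ℂ) ≠ 0 := by exact_mod_cast hm.ne'
  rwa [Submodule.smul_mem_iff _ hm0] at hmem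

/-- **Cor. 5.7 with the hypothesis on the Chow group** `CH₀(X) = Z₀(X)/Rat₀(X)`
(`Motives.ChowGroup`): if any two classes of `CH₀(X)` are `ℤ`-linearly dependent
(`dim_ℚ CH₀(X) ⊗ ℚ ≤ 1`), then `N¹ Hᵏ(X(ℂ); ℂ) = Hᵏ(X(ℂ); ℂ)` for every `k ≥ 1`, granted `G`.
[cite: Voisin2025, Cor. 5.7] [cite: BlochSrinivas1983, Thm. 1] -/
theorem GysinFormalism.supportedClasses_eq_top_of_chowGroup_zero (G : GysinFormalism)
    (hX : IsSmoothProjective n X)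
    (hCH : ∀ a b : ChowGroup X.left 0, ∃ p q : ℤ, (p ≠ 0 ∨ q ≠ 0) ∧ p • a = q • b)
    {k : ℕ} (hk : 1 ≤ k) : supportedClasses X k 1 = ⊤ :=
  G.supportedClasses_eq_top_of_chowRankLEOneUpTo_zero hX
    ((chowRankLEOneUpTo_iff_chowGroup X 0).2 fun j hj ↦ by
      obtain rfl : j = 0 := Nat.le_zero.mp hj
      exact hCH) hk

end HodgeTheory

end Literature.AlgebraicGeometry.HodgeTheory

end
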